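import Mathlib
import HarnessLib

/-!
# Route `KLProgramme` — crux C4a, S3 brick (B4) «(U1)-LAWS» part 7: GLUE — the double integral of a box is majorised by BOTH iterated absolute integrals (Fubini on a
# continuous integrand), and the levels far from the Fermi surface are trivial (`1/e₁²` envelope)

Cell `gate-hubbard-kl`, seat hubbard-kl-k3c3-p3 (g31; row «implicit-function / monotonicity route for μ(n)»).  Located brick for the (C)-closer lane / the (M4)
assembly of the umklapp first-order ϑ-layer (stub (C) `stub_twoLeg_curvature` of `KLRegimeEngineV17F2`, stmt-HubbardSuperconductivity-20437), memo
HOME/hubbard-kl-k3c3-p3/U1-CAUSTIC-SUP.md §11.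

WHY.  The cover theorem wants ONE nonnegative `F(ϑ)` obeying all three laws.  Per near-caustic box the natural choice is the absolute value of the DOUBLE integral
`F = |∫_{lo..hi} ∫_{α..β} w(e)·Ψ(e,v) dv de|` (`Ψ = X·(K e)′(ē)`): the two-sided and post-side laws (parts 4a/4b) bound `∫de w·|∫dv Ψ|`, the pre-side law (part 5d) bounds
`∫dv |∫de w·Ψ|`; this file records the two majorisations `F ≤ ∫de w|∫dv Ψ|` and (Fubini, continuous integrand) `F ≤ ∫dv|∫de wΨ|`, and the trivial bound for the levels
`e ∈ [e₁, hi]` kept away from the Fermi surface, where the kernel envelope `|(K e)′u| ≤ 1/max(e,|u|)² ≤ 1/e₁²` needs no fold structure.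
* §1 `intervalIntegral_swap_of_continuousOn` (Fubini on `[lo,hi] × [α,β]` for a continuous integrand); **`abs_intervalIntegral2_le_outer`** (`F ≤ ∫de w·|∫dv Ψ|`, `w ≥ 0`);
  **`abs_intervalIntegral2_le_inner`** (`F ≤ ∫dv |∫de w·Ψ|`).
* §2 **`intervalIntegral_highLevels_le`**: `∫_{e₁..hi} w(e)·|∫_{α..β} X(e,v)·(K e)′(g e v) dv| de ≤ W·X₀·(β − α)/e₁²·(hi − e₁)` from the envelope alone (no integrability,
  no fold hypotheses) — the complement of the fold-box levels `[lo, e₁]`.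
Pure real analysis; nothing about the model; nothing asserts (C), K3 or superconductivity.
References: Salmhofer 1999 §4.5.3 [cite: Salmhofer1999]; FST II CPAM 51 (1998) §3 [cite: FeldmanSalmhoferTrubowitz1998].
-/

noncomputable section

namespace Summit.HubbardSuperconductivity.HubbardSuperconductivity.Theorems.C4a

set_option linter.dupNamespace false -- summit = problem name (single-conjunct summit), D-0017

open Real Set MeasureTheory intervalIntegral
open scoped Interval

/-! ## §1 The double integral against the two iterated absolute integrals -/

/-- **Fubini on a box for a continuous integrand**: `∫_{lo..hi} ∫_{α..β} Φ = ∫_{α..β} ∫_{lo..hi} Φ` (`lo ≤ hi`, `α ≤ β`, `Φ` continuous on `[lo,hi] × [α,β]`). -/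
theorem intervalIntegral_swap_of_continuousOn {Φ : ℝ → ℝ → ℝ} {lo hi α β : ℝ} (hlohi : lo ≤ hi) (hαβ : α ≤ β)
    (hΦ : ContinuousOn (fun p : ℝ × ℝ => Φ p.1 p.2) (Icc lo hi ×ˢ Icc α β)) :
    ∫ e in lo..hi, ∫ v in α..β, Φ e v = ∫ v in α..β, ∫ e in lo..hi, Φ e v := by
  have hK : IsCompact (Icc lo hi ×ˢ Icc α β) := isCompact_Icc.prod isCompact_Icc
  have hint : IntegrableOn (fun p : ℝ × ℝ => Φ p.1 p.2) (Ioc lo hi ×ˢ Ioc α β) :=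
    (hΦ.integrableOn_compact hK).mono_set (prod_mono Ioc_subset_Icc_self Ioc_subset_Icc_self)
  rw [IntegrableOn, Measure.volume_eq_prod, ← Measure.prod_restrict] at hint
  have hswap := MeasureTheory.integral_integral_swap (f := fun e v => Φ e v) hint
  simp only [intervalIntegral.integral_of_le hlohi, intervalIntegral.integral_of_le hαβ]
  exact hswap

/-- **`F ≤ ∫de w·|∫dv Ψ|`**: for `lo ≤ hi` and a profile `w ≥ 0` on `[lo,hi]`,
`|∫_{lo..hi} ∫_{α..β} w(e)·Ψ(e,v) dv de| ≤ ∫_{lo..hi} w(e)·|∫_{α..β} Ψ(e,v) dv| de`.  (No integrability hypothesis.) -/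
theorem abs_intervalIntegral2_le_outer {Ψ : ℝ → ℝ → ℝ} {w : ℝ → ℝ} {lo hi α β : ℝ} (hlohi : lo ≤ hi) (hw0 : ∀ e ∈ Icc lo hi, 0 ≤ w e) :
    |∫ e in lo..hi, ∫ v in α..β, w e * Ψ e v| ≤ ∫ e in lo..hi, w e * |∫ v in α..β, Ψ e v| := by
  have h1 : (∫ e in lo..hi, ∫ v in α..β, w e * Ψ e v) = ∫ e in lo..hi, w e * ∫ v in α..β, Ψ e v := by
    refine intervalIntegral.integral_congr fun e _ => ?_
    simp only [intervalIntegral.integral_const_mul]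
  rw [h1]
  refine (intervalIntegral.abs_integral_le_integral_abs hlohi).trans (le_of_eq ?_)
  refine intervalIntegral.integral_congr fun e he => ?_
  rw [uIcc_of_le hlohi] at he
  simp only [abs_mul, abs_of_nonneg (hw0 e he)]

/-- **`F ≤ ∫dv |∫de w·Ψ|`** (Fubini): for `lo ≤ hi`, `α ≤ β` and `(e,v) ↦ w(e)Ψ(e,v)` continuous on the box,
`|∫_{lo..hi} ∫_{α..β} w(e)·Ψ(e,v) dv de| ≤ ∫_{α..β} |∫_{lo..hi} w(e)·Ψ(e,v) de| dv`. -/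
theorem abs_intervalIntegral2_le_inner {Ψ : ℝ → ℝ → ℝ} {w : ℝ → ℝ} {lo hi α β : ℝ} (hlohi : lo ≤ hi) (hαβ : α ≤ β)
    (hΦ : ContinuousOn (fun p : ℝ × ℝ => w p.1 * Ψ p.1 p.2) (Icc lo hi ×ˢ Icc α β)) :
    |∫ e in lo..hi, ∫ v in α..β, w e * Ψ e v| ≤ ∫ v in α..β, |∫ e in lo..hi, w e * Ψ e v| := by
  rw [intervalIntegral_swap_of_continuousOn (Φ := fun e v => w e * Ψ e v) hlohi hαβ hΦ]
  exact intervalIntegral.abs_integral_le_integral_abs hαβ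

/-! ## §2 The levels away from the Fermi surface -/

/-- **THE HIGH LEVELS ARE TRIVIAL**: `0 < e₁ ≤ hi`, `α ≤ β`; kernel envelope `|(K e)′u| ≤ 1/max(e,|u|)²` for `e ∈ [e₁,hi]`; weight `|X e v| ≤ X₀` on the window;
profile `0 ≤ w ≤ W`.  THEN `∫_{e₁..hi} w(e)·|∫_{α..β} X(e,v)·(K e)′(g e v) dv| de ≤ W·X₀·(β − α)/e₁²·(hi − e₁)` — no fold structure, no integrability hypothesis. -/
theorem intervalIntegral_highLevels_le {g X K : ℝ → ℝ → ℝ} {w : ℝ → ℝ} {e₁ hi α β X₀ W : ℝ} (he₁ : 0 < e₁) (he₁hi : e₁ ≤ hi) (hαβ : α ≤ β)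
    (hK1 : ∀ e ∈ Icc e₁ hi, ∀ u, |deriv (K e) u| ≤ (max e |u|)⁻¹ ^ 2)
    (hXb : ∀ e ∈ Icc e₁ hi, ∀ v ∈ Icc α β, |X e v| ≤ X₀)
    (hw0 : ∀ e ∈ Icc e₁ hi, 0 ≤ w e) (hw : ∀ e ∈ Icc e₁ hi, w e ≤ W) :
    ∫ e in e₁..hi, w e * |∫ v in α..β, X e v * deriv (K e) (g e v)| ≤ W * X₀ * (β - α) / e₁ ^ 2 * (hi - e₁) := by
  have he₁I : e₁ ∈ Icc e₁ hi := left_mem_Icc.2 he₁hi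
  have hX00 : 0 ≤ X₀ := (abs_nonneg _).trans (hXb e₁ he₁I α (left_mem_Icc.2 hαβ))
  have hW0 : 0 ≤ W := (hw0 e₁ he₁I).trans (hw e₁ he₁I)
  -- inner bound
  have hinner : ∀ e ∈ Icc e₁ hi, |∫ v in α..β, X e v * deriv (K e) (g e v)| ≤ X₀ / e₁ ^ 2 * (β - α) := fun e he => by
    have hpt : ∀ v ∈ Ι α β, ‖X e v * deriv (K e) (g e v)‖ ≤ X₀ / e₁ ^ 2 := fun v hv => by
      rw [uIoc_of_le hαβ] at hv
      rw [Real.norm_eq_abs, abs_mul, div_eq_mul_inv]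
      refine mul_le_mul (hXb e he v (Ioc_subset_Icc_self hv)) ?_ (abs_nonneg _) hX00
      refine (hK1 e he (g e v)).trans ?_
      rw [inv_pow]
      have he0 : 0 < e := he₁.trans_le he.1
      exact inv_anti₀ (by positivity) (pow_le_pow_left₀ he₁.le (he.1.trans (le_max_left _ _)) 2)
    have h := intervalIntegral.norm_integral_le_of_norm_le_const hpt
    rw [Real.norm_eq_abs, abs_of_nonneg (sub_nonneg.2 hαβ)] at h
    exact h
  -- outer bound
  have hpt : ∀ e ∈ Ι e₁ hi, ‖w e * |∫ v in α..β, X e v * deriv (K e) (g e v)|‖ ≤ W * (X₀ / e₁ ^ 2 * (β - α)) := fun e he => by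
    rw [uIoc_of_le he₁hi] at he
    have heI : e ∈ Icc e₁ hi := Ioc_subset_Icc_self he
    rw [Real.norm_eq_abs, abs_mul, abs_of_nonneg (hw0 e heI), abs_abs]
    exact mul_le_mul (hw e heI) (hinner e heI) (abs_nonneg _) hW0
  have h := intervalIntegral.norm_integral_le_of_norm_le_const hpt
  rw [Real.norm_eq_abs, abs_of_nonneg (sub_nonneg.2 he₁hi)] at h
  refine (le_abs_self _).trans (h.trans (le_of_eq ?_))
  ring

end Summit.HubbardSuperconductivity.HubbardSuperconductivity.Theorems.C4a

end
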